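import Mathlib
import Summits.KontsevichZagierPeriods.Zeta5Search.ZeroWindowClasses
import Summits.KontsevichZagierPeriods.Zeta5Search.RecordWindowsA4
import Summits.KontsevichZagierPeriods.Zeta5Search.ClassDataDecide
import Summits.KontsevichZagierPeriods.Zeta5Search.AtlasRayRecord
import Summits.KontsevichZagierPeriods.Zeta5Search.CellKitCentre
import Summits.KontsevichZagierPeriods.Zeta5Search.A4WindowM52P1
import Summits.KontsevichZagierPeriods.Zeta5Search.TSWindowO54P1
import Summits.KontsevichZagierPeriods.Zeta5Search.LawA4Proof
import Summits.KontsevichZagierPeriods.Zeta5Search.FourthOrderResidue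
import Summits.KontsevichZagierPeriods.Zeta5Search.RecordCellAAtlasNotMin
import Summits.KontsevichZagierPeriods.Zeta5Search.A4WindowM56P1
import Summits.KontsevichZagierPeriods.Zeta5Search.A4WindowM56P2
import Summits.KontsevichZagierPeriods.Zeta5Search.A4WindowM56P3
import Summits.KontsevichZagierPeriods.Zeta5Search.A4WindowM56P4
import Summits.KontsevichZagierPeriods.Zeta5Search.A4WindowM56P5
import Summits.KontsevichZagierPeriods.Zeta5Search.A4WindowM56P6
import Summits.KontsevichZagierPeriods.Zeta5Search.A4WindowM56P7
import Summits.KontsevichZagierPeriods.Zeta5Search.A4WindowM56P8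
import Summits.KontsevichZagierPeriods.Zeta5Search.A4WindowM56P9
import Summits.KontsevichZagierPeriods.Zeta5Search.A4WindowM56P10
import Summits.KontsevichZagierPeriods.Zeta5Search.A4WindowM56P11
import Summits.KontsevichZagierPeriods.Zeta5Search.A4WindowM56P12
import Summits.KontsevichZagierPeriods.Zeta5Search.A4WindowM56P13
import Summits.KontsevichZagierPeriods.Zeta5Search.A4WindowM56P14
import Summits.KontsevichZagierPeriods.Zeta5Search.A4WindowM56P15
import Summits.KontsevichZagierPeriods.Zeta5Search.A4WindowM56P16
import Summits.KontsevichZagierPeriods.Zeta5Search.A4WindowM56P17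
import Summits.KontsevichZagierPeriods.Zeta5Search.A4WindowM56P18
import Summits.KontsevichZagierPeriods.Zeta5Search.A4WindowM56P19
import Summits.KontsevichZagierPeriods.Zeta5Search.A4WindowM56P20
import Summits.KontsevichZagierPeriods.Zeta5Search.A4WindowM56P21
import HarnessLib

/-!
# ζ(5) search — LawA4 (THEOREM A⁗,
    casLB + 4) record window `M = 56` of `RecordWindowsA4.lean`: `RecClassesM56` (part 22/22) (HONEST FRAMING: systematic search; no irrationality claim unless certified)

Cell `pub-zeta5`, prover seat p3 generation 3.  MACHINE-GENERATED by `code/gen/zwgen.py` (p3 g3) in the format of P1's atlas machine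
(`AtlasCellRec*`): exact scale-free class analysis of the record ray `bRec n = bLin (11n) (7n) n` on the window `17 * n < 18 * p`, `p ≤ n`
(all odd `p`, all `n ≤ 300`: 1325 instances; class lengths `[41, 42, 43, 44]`, bracket signatures per length `{41: 2, 42: 15, 43: 20, 44: 1}`),
    every statement then
PROVED (`omega` leaf by leaf).  Bracket classification generated afresh (one LEAF theorem per signature, decision tree inline in `zw_L*`).
Target: gen-2 g12's `@[conjecture]` node `RecordWindowsA4.RecClassesM56` (`LawA4Classes (bRec n) p 56 T56`: one deep palindrome `T56`,
single raises at `−55`, admissible double raises at `−54`) and hence the window bound `RecordWindowsA4.RecWindowM56` (-105) by the landed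
reduction `recWindowM56_of` and typer g12's `SecondOrder.lawA4_holds`.  Integer bookkeeping (`netExp` along residue classes);
valuations of rationals; nothing here bears on irrationality.
-/

open Finset

namespace Summit.KontsevichZagierPeriods.Zeta5Search.A4WindowM56

open Summit.KontsevichZagierPeriods.Zeta5Search.ClusterValuation (netExp classSet CentreIn classExp conjClass bRec classPoleCount)
open Summit.KontsevichZagierPeriods.Zeta5Search.CasoratianValuation (InPolytope shift casoratian)
open Summit.KontsevichZagierPeriods.Zeta5Search.CellKit
open Summit.KontsevichZagierPeriods.Zeta5Search.SecondOrder (classTypeList isRaise isRaise2 classTypeList_level lawA4_holds)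
open Summit.KontsevichZagierPeriods.Zeta5Search.AtlasRayRecord
open Summit.KontsevichZagierPeriods.Zeta5Search.RecordWindowsA4


variable {p : ℕ} [hp : Fact p.Prime]

/-- **`RecordWindowsA4.RecClassesM56` IS A THEOREM**: the five class clauses of `LawA4` for `bRec n`, `M = 56`, `T = T56` on the window
`17 * n < 18 * p`, `p ≤ n`, for every `n` and every odd prime of the window (the hypothesis `41n + 2 < p²` is not needed).  Per class the
structure theorems `zw_L*` give the clauses with `classExp`; single-pole classes have `classNu ≥ classExp ≥ −6` (tree lemmas
`ResidueFour.neg_six_le_classExp_of_classPoleCount_le_one`, `CellA.classExp_le_classNu`), multipole classes have `classNu = classExp`. -/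
theorem recClassesM56_holds : RecClassesM56 := by
  intro n p _hn hprime h1 h2 _hsq
  haveI : Fact p.Prime := ⟨hprime⟩
  have hp2 : p % 2 = 1 := by
    rcases hprime.eq_two_or_odd with rfl | h
    · have h4 : (2 : ℕ) ^ 2 = 4 := by norm_num
      omega
    · exact h
  have key : ∀ x, x < p →
      (-56 : ℤ) ≤ classExp (bRec n) p x ∧
      (classExp (bRec n) p x = -56 → ¬ CentreIn (bRec n) p x ∧ classTypeList (bRec n) p x = T56) ∧
      (classExp (bRec n) p x = -55 →
        isRaise T56 (classTypeList (bRec n) p x) = true ∨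
          (¬ (2 : ℤ) ∣ (bRec n) 0 ∧ CentreIn (bRec n) p x ∧ classTypeList (bRec n) p x = T56)) ∧
      (classExp (bRec n) p x = -54 → isRaise2 T56 (classTypeList (bRec n) p x) = true) := by
    intro x hx
    rw [bRec_eq_bLin]
    rcases Nat.lt_or_ge (41 * n) (x + 43 * p) with hL43 | hL43
    · rcases Nat.lt_or_ge (41 * n) (x + 42 * p) with hL42 | hL42
      · rcases Nat.lt_or_ge (41 * n) (x + 41 * p) with hL41 | hL41
        · exact zw_L40 h1 h2 hp2 hx (by omega) (by omega)
        · exact zw_L41 h1 h2 hp2 hx (by omega) (by omega)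
      · exact zw_L42 h1 h2 hp2 hx (by omega) (by omega)
    · exact zw_L43 h1 h2 hp2 hx (by omega) (by omega)
  have hnu : ∀ y, y < p → 1 ≤ classPoleCount (bRec n) p y → ClusterValuation.classNu (bRec n) p y ≤ -6 - 1 →
      ClusterValuation.classNu (bRec n) p y = classExp (bRec n) p y := by
    intro y _ _ hle
    by_cases h1p : classPoleCount (bRec n) p y ≤ 1
    · have h6 := ResidueFour.neg_six_le_classExp_of_classPoleCount_le_one (bRec n) p y h1p
      have h7 := CellA.classExp_le_classNu (bRec n) p y
      omega
    · unfold ClusterValuation.classNu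
      rw [if_neg (fun h => absurd h.1 (by omega))]
  unfold LawA4Classes
  refine ⟨fun x hx => ?_, fun y hy h1p => ?_, fun x hx hE => ?_, fun y hy hpc hny => ?_, fun z hz hpc hnz => ?_⟩
  · simp only [ClusterValuation.multipoleClasses, Finset.mem_filter, Finset.mem_range] at hx
    exact (key x hx.1).1
  · have h6 := ResidueFour.neg_six_le_classExp_of_classPoleCount_le_one (bRec n) p y (by omega)
    have h7 := CellA.classExp_le_classNu (bRec n) p y
    omega
  · simp only [ClusterValuation.multipoleClasses, Finset.mem_filter, Finset.mem_range] at hx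
    exact (key x hx.1).2.1 hE
  · have hcl := hnu y hy hpc (by omega)
    exact (key y hy).2.2.1 (by omega)
  · have hcl := hnu z hz hpc (by omega)
    exact (key z hz).2.2.2 (by omega)

/-- **`RecordWindowsA4.RecWindowM56` IS A THEOREM**: `v_p(Cas₇(b(n))) ≥ -105` (`= 7 − 2·56 = casLB + 4`) at every prime of the record window
`17 * n < 18 * p`, `p ≤ n` with `41n + 2 < p²` — UNCONDITIONAL: typer g12's tree theorem `SecondOrder.lawA4_holds : LawA4` (THEOREM A⁗) +
gen-2 g12's reduction `recWindowM56_of` + the class structure `recClassesM56_holds`. -/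
theorem recWindowM56_holds : RecWindowM56 := recWindowM56_of lawA4_holds recClassesM56_holds

end Summit.KontsevichZagierPeriods.Zeta5Search.A4WindowM56
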